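import Summits.ResolutionOfSingularities.ResolutionOfSingularities.Theorems.PurelyInseparableDim4ChartAtlasSNCFarRepairGlobal
import Summits.ResolutionOfSingularities.ResolutionOfSingularities.Theorems.PurelyInseparableDim4ChartAtlasSNCRepairAdmissible
import HarnessLib

/-!
# Purely inseparable four-folds `z^p + F(x₁, …, x₄)`: AFTER THE FAR-RESONANCE REPAIR the strict transform of the escaping centre is an ADMISSIBLE
# centre — regular, inside the support, snc with the transformed boundary (S3-N2 repair, far class, step 5; cell `res-dim4-pi`, typ-2 g6)

[OURS · counted 0] (D-0157 DOOR 2; DR-157-C; desk WORD #115 (a)/(c), #131 (c); crit-3 g5's (b)). The far analogue of p696436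
(`admissible_strictTransform_after_repair`): on the chart model of the escaping step in the translated frame `y_j ↦ y_j - c'` (so the hypersurface
is `z^p + F` with `F` the translated polynomial, `T`-permissible), with the translated boundary `E` of p706678/p708880 (hyperplanes `H₀`, translated far
quadrics `TQ_k`), for ANY blowing up `π'` of `𝔸⁵` along the resonance locus `Σ = V(y_0, y_T, y_j)`: PROVED here (no `sorry`, no new axiom)

* **`admissible_strictTransform_after_farRepair`** — `C' = St_{π'}(V(y_0, y_T))` is REGULAR, `V(C') ⊆ supp M'` for the transform
  `M' = ((z^p + F)·𝒪, E, p).transform π' 𝓘_Σ`, and `HasSNCWith M'.boundary C'` — i.e. `C'` is an admissible centre for `M'`: the three clauses of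
  BGMW Def. 3.1.3 (1)(2) (p696436's regularity and support arguments verbatim over the single chart `y_j`; the snc clause is p708880).

WORDS: «if two far old members resonate with the escaping centre, blow up the resonance locus `Σ` (codim 1 in the centre) first; then the strict
transform of the centre is admissible» — the FAR REPAIR CANDIDATE ‖ K on the chart model, one extra blow-up, cost rider r5 verbatim; its transport
to the walk's stage objects is typ-3's assembly, as for the near repair. Nothing here is a statement about resolution of singularities in dimension
≥ 4 / characteristic `p` (NOT proved anywhere in this programme). bears_on: LADDER-RESOLUTION:D157-DOOR2 (res-dim4-pi). Supports
stmt-ResolutionOfSingularities-16155 (helper, S3-N2 far repair).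
-/

-- every declaration of this summit lives under `Summit.ResolutionOfSingularities.ResolutionOfSingularities`
-- (summit = problem), which the duplicate-namespace linter flags; house convention (cf. the Target file).
set_option linter.dupNamespace false

noncomputable section

open MvPolynomial Finset CategoryTheory AlgebraicGeometry Opposite TopologicalSpace
open AlgebraicGeometry.Scheme.IdealSheafData (ofIdealTop vanishingIdeal)

namespace Summit.ResolutionOfSingularities.ResolutionOfSingularities.Theorems.PIDim4

open Literature.AlgebraicGeometry.Resolution
open Literature.AlgebraicGeometry.Resolution.AffinePointBlowup (P A γ coord Wtop ξ)

namespace ChartDictionary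

variable {K : Type} [Field K] {p : ℕ} {T : Finset (Fin 4)} {j : Fin 4} {b e : Fin 4 → K} {c' : K}
  {W' : Scheme.{0}} {π' : W' ⟶ P 4 K}

/-- **AFTER THE FAR-RESONANCE REPAIR THE STRICT TRANSFORM OF THE ESCAPING CENTRE IS ADMISSIBLE** (chart model, translated frame). Hypotheses as in
p708880's `hasSNCWith_transform_boundary_strictTransform_after_farRepair`, plus `T`-permissibility of `z^p + F` and ONE resonant member `k₀ ∈ fs ∩ T`
(so that `T ≠ ∅` and the chart transform along `Σ` stays `T`-permissible, as in p696436 with its `m ∈ T`). -/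
theorem admissible_strictTransform_after_farRepair (hjT : j ∉ T) (hc' : c' ≠ 0) (H₀ : Finset (Fin (4 + 1) × K)) (fs : Finset (Fin 4))
    (hjfs : j ∉ fs) (hd : ∀ k ∈ fs, e k + b k * c' ≠ 0) (hC1 : ∀ k ∈ fs, ∀ a : K, (k.succ, a) ∈ H₀ → a = b k)
    (hHj : ∀ a : K, (j.succ, a) ∈ H₀ → a ≠ 0 → ∀ k ∈ fs, k ∈ T → e k ≠ 0 → b k ≠ 0 → e k ≠ a * b k)
    (hNh : ∀ k ∈ fs, ∀ k' ∈ fs, k ∈ T → k' ∈ T → e k ≠ 0 → e k' ≠ 0 → k ≠ k' → b k ≠ 0 → b k' ≠ 0 → e k * b k' ≠ e k' * b k)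
    {k₀ : Fin 4} (hk₀ : k₀ ∈ T) {E : List (Scheme.IdealSheafData (P 4 K))}
    (hE : ∀ D ∈ E, D = ⊤ ∨ (∃ ma ∈ H₀, D = ofIdealTop (Ideal.span {(γ 4 K).symm (X ma.1 + C ma.2)})) ∨
      ∃ k ∈ fs, D = ofIdealTop (Ideal.span {(γ 4 K).symm ((X k.succ + C (b k)) * X j.succ - C c' * X k.succ + C (e k))}))
    (F : MvPolynomial (Fin 4) K) (hperm : (p : ℕ∞) ≤ CentreBlowup.ordAlong T F)
    (hπ' : IsBlowup π' (AffineCoordBlowup.𝓘Λ 4 K (insert 0 (Fin.succ '' ((insert j T : Finset (Fin 4)) : Set (Fin 4)))))) :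
    let M' := ((⟨hypSheaf p F, E, p⟩ : MarkedIdeal (P 4 K)).transform π'
      (AffineCoordBlowup.𝓘Λ 4 K (insert 0 (Fin.succ '' ((insert j T : Finset (Fin 4)) : Set (Fin 4))))))
    let C' := strictTransformIdeal π' (AffineCoordBlowup.𝓘Λ 4 K (insert 0 (Fin.succ '' ((insert j T : Finset (Fin 4)) : Set (Fin 4)))))
      (AffineCoordBlowup.𝓘Λ 4 K (insert 0 (Fin.succ '' (T : Set (Fin 4)))))
    Scheme.IsRegular C'.subscheme ∧ (C'.support : Set W') ⊆ M'.support ∧ HasSNCWith M'.boundary C' := by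
  intro M' C'
  haveI : IsProper π' := hπ'.isProper
  haveI : IsLocallyNoetherian W' := LocallyOfFiniteType.isLocallyNoetherian π'
  have hj' : j ∈ insert j T := Finset.mem_insert_self j T
  set ΛT : Set (Fin (4 + 1)) := insert 0 (Fin.succ '' (T : Set (Fin 4))) with hΛT
  -- the single chart `y_j` covers `V(C')`, and `C'` reads `𝓘Λ_T` there
  have hcov : (C'.support : Set W') ⊆ ⋃ _ : Unit, Set.range (AffineCoordBlowup.chartImm hπ' (succ_mem_centreVars hj')) := fun w hw =>
    Set.mem_iUnion.mpr ⟨(), support_strictTransform_escapingCentre_after_farRepair_subset hπ' hw⟩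
  have hread : C'.comap (AffineCoordBlowup.chartImm hπ' (succ_mem_centreVars hj')) = AffineCoordBlowup.𝓘Λ 4 K ΛT :=
    comap_chartImm_strictTransform_escapingCentre_after_farRepair hjT hπ'
  -- permissibility downstairs for `Σ` and on the chart for `T`
  have hpermIns : (p : ℕ∞) ≤ CentreBlowup.ordAlong (insert j T) F :=
    hperm.trans (CentreBlowup.ordAlong_mono (Finset.subset_insert j T) F)
  have hperm' : (p : ℕ∞) ≤ CentreBlowup.ordAlong T (CentreBlowup.chartTransform p (insert j T) j F) :=
    (Equimultiple.isPermissibleCentre_chartTransform_of_not_mem p p (insert j T) hjT (P := F) ⟨⟨k₀, hk₀⟩, hperm⟩).2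
  refine ⟨?_, ?_, ?_⟩
  · -- regular
    refine isRegular_subscheme_of_cover_comap (fun _ : Unit => AffineCoordBlowup.chartImm hπ' (succ_mem_centreVars hj')) hcov fun _ => ?_
    rw [hread]
    exact Literature.AlgebraicGeometry.Hironaka2017.Lib.AffineCoordBlowupLSB.isRegular_CΛ 4 K ΛT
  · -- inside the support
    refine support_subset_of_cover_comap (fun _ : Unit => AffineCoordBlowup.chartImm hπ' (succ_mem_centreVars hj')) hcov fun _ => ?_
    intro y hy
    rw [hread, AffineCoordBlowup.support_𝓘Λ] at hy
    change (AffineCoordBlowup.chartImm hπ' (succ_mem_centreVars hj')) y ∈ M'.support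
    change ((M'.mult : ℕ) : ℕ∞) ≤ idealOrder M'.ideal _
    rw [MarkedIdeal.transform_mult, ← idealOrder_comap_of_isOpenImmersion (AffineCoordBlowup.chartImm hπ' (succ_mem_centreVars hj')),
      comap_chartImm_transform_ideal_model hj' F hpermIns E hπ']
    exact le_idealOrder_hypSheaf_of_mem_CΛ p T _ hperm' hy
  · -- snc with the transformed boundary
    rw [MarkedIdeal.transform_boundary]
    exact hasSNCWith_transform_boundary_strictTransform_after_farRepair hjT hc' H₀ fs hjfs hd hC1 hHj hNh hE hπ'

end ChartDictionary

end Summit.ResolutionOfSingularities.ResolutionOfSingularities.Theorems.PIDim4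

end
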